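import Summits.Parity.GeneralizedHardyLittlewood.Theorems.BeyondDiagonalBeatsQuarter.OffDiagCoreWinKernelBounds
import Summits.Parity.GeneralizedHardyLittlewood.Theorems.BeyondDiagonalBeatsQuarter.OffDiagCoreWinSeparatedBlock
import Summits.Parity.GeneralizedHardyLittlewood.Theorems.BeyondDiagonalBeatsQuarter.OffDiagUniversalLevelWeight
import Mathlib.Analysis.SpecificLimits.Basic
import HarnessLib

/-!
# Route `PrimeLevelFamEdge`, crux K_B (stmt-Parity-20343), line `diagonal_kernel_split` rev 4, plan Ω — node L7d part 2,
# leaf G7a: one (block, k, w) bound of G5/G6 with the completion index `k` summed out of the member weights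
`B_{b,k,w} ≤ 2·sepWeight(2N+1,k)·[2√(4#G_b/N)·√FIBΩ_{b,w}·LS + J2^{−J}·MASSΩ_{b,w}·2#G_b/√N]`, the `k`-FREE weight being
`Ω_{x,b,w} = 𝟙[x active in block b]·|t_{w₁}(l)t_{w₂}(m)|·K₁K₂·KB_x` (inactive members have `convexCoeff = 0`); universal factors by $₁.
**`blockBound_le_sepWeight_mul`**. Helper; standard axioms; closes nothing. «The programme SEARCHES and TYPES; no claim about
Landau–Siegel zeros, Theorems 1–2 of arXiv:2211.02515 or a repaired Margin232 until a kernel theorem says so.»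
-/

noncomputable section

open Finset Real Complex MeasureTheory Polynomial
open scoped Nat

namespace Summit.Parity.GeneralizedHardyLittlewood.Theorems.BeyondDiagonalBeatsQuarter.OffDiag

open Literature.Analysis.FunctionSpaces (besselJ)
open Literature.Analysis.Calculus.WhitneyConvex (dyadicBump)
open Literature.NumberTheory.LFunctions Literature.NumberTheory.LFunctions.KMV2000
open Literature.NumberTheory.Sieve.FriedlanderIwaniecPrimes (fourier2 ker)
open Literature.NumberTheory.Sieve.LargeSieve (e sepCoeff sepWeight sepWeight_nonneg)
open PeterssonSplit (nearBoxes)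

open Classical in
/-- **One (block, k, w) bound with `k` summed out of the member weights.** Hypotheses: `1 ≤ N`, `1 ≤ L ≤ N`, levels `G` prime in
`(N,2N]` with `q̂(q)^{Δ′} ≥ e`, `k < 2N+1`, selector values `‖D‖ ≤ 1`; any `b`, `w`, `J`, `R`, `H_D`, `ε₀`, `T`.
[cite: KowalskiMichelVanderKam2000, §6 p. 19 — derivation; Vaughan1980, Lemma 2 — derivation] -/
theorem blockBound_le_sepWeight_mul (R : ℕ) {D : ℕ → ℕ → ℕ → ℕ → ℕ → ℕ × ℕ → ℤ → ℤ → ℂ}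
    (hDn : ∀ r l m d₁ d₂ i h₁ s, ‖D r l m d₁ d₂ i h₁ s‖ ≤ 1) {N H_D : ℕ} (hN : 1 ≤ N)
    (T : ℕ → ℕ → ℕ → ℕ → ℕ → ℕ × ℕ → ℤ → ℕ) (G : Finset ℕ) {L : ℕ} (hL : 1 ≤ L) (hLN : L ≤ N)
    (hG : ∀ q ∈ G, q.Prime ∧ N < q ∧ q ≤ 2 * N) {Δ' : ℝ} (hGe : ∀ q ∈ G, Real.exp 1 ≤ qhat q ^ Δ') (ε₀ : ℝ) (b : ℕ)
    {k : ℕ} (hk : k < 2 * N + 1) (w : ℕ × ℕ) (J : ℕ) :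
    ((∑ j ∈ Finset.range J, (1 / 2 : ℝ) ^ j *
          Real.sqrt (∑ q ∈ G.filter (fun q ↦ (q - N) / L = b),
            ‖(e ((k : ℝ) * q / (2 * N + 1 : ℕ)) * (2 * (qhat q : ℂ) * (2 * π / q)) *
                (((Real.log (qhat q ^ Δ'))⁻¹ ^ (w.1 + w.2) : ℝ) : ℂ)) *
              ((((((q : ℝ))⁻¹ - (((N + b * L + (L - 1) + 1 : ℕ) : ℝ))⁻¹) /
                ((((N + b * L : ℕ) : ℝ))⁻¹ - (((N + b * L + (L - 1) + 1 : ℕ) : ℝ))⁻¹)) ^ j : ℝ) : ℂ)‖ ^ 2))) *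
        (Real.sqrt (∑ h ∈ Finset.Icc 1 H_D, ∑ c' ∈ (Finset.range h).filter (fun c' ↦ c'.Coprime h),
            (∑ x ∈ ((memberSet G (2 * N) N (coreHeight ε₀) T Δ').filter (fun x ↦ x.h₁ ≠ 0 ∧
                (((switchGcd (x.r + 1) x.s x.h₁ : ℤ) ∣ ((x.l / x.d₁ : ℕ) : ℤ) * (x.m / x.d₂ : ℕ) ∧
                  IsUnit (switchClass (x.r + 1) (((x.l / x.d₁ : ℕ) : ℤ) * (x.m / x.d₂ : ℕ)) x.s x.h₁))) ∧
                D x.r x.l x.m x.d₁ x.d₂ x.i x.h₁ x.s ≠ 0)).filter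
                (fun x ↦ switchMod (x.r + 1) x.s x.h₁ = h ∧
                  (switchClass (x.r + 1) (((x.l / x.d₁ : ℕ) : ℤ) * (x.m / x.d₂ : ℕ)) x.s x.h₁).val = c'),
              ‖((if Nat.Coprime (x.l / x.d₁) (x.r + 1) then (1 : ℂ) else 0) *
                  ((if IsUnit ((x.h₁ : ℤ) : ZMod (x.r + 1)) ∧ x.h₁ ≠ 0 then (1 : ℂ) else 0) *
                    (if ((switchGcd (x.r + 1) x.s x.h₁ : ℤ) ∣ ((x.l / x.d₁ : ℕ) : ℤ) * (x.m / x.d₂ : ℕ) ∧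
                        IsUnit (switchClass (x.r + 1) (((x.l / x.d₁ : ℕ) : ℤ) * (x.m / x.d₂ : ℕ)) x.s x.h₁)) then (1 : ℂ) else 0) *
                    D x.r x.l x.m x.d₁ x.d₂ x.i x.h₁ x.s) *
                  convexCoeff (fun q ↦ (coreRange Δ' ε₀ x.r x.l x.m x.d₁ x.d₂ x.i x.h₁ q ∧
                      ¬ ((T x.r x.l x.m x.d₁ x.d₂ x.i x.h₁ : ℝ) <
                        |(x.s : ℝ) + ((((x.l / x.d₁ : ℕ) : ℤ) * (x.m / x.d₂ : ℕ) : ℤ) : ℝ) / ((q * (x.r + 1) : ℕ) : ℝ)|)) ∧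
                      (N + b * L ≤ q ∧ q ≤ N + b * L + (L - 1))) (2 * N + 1) k *
                  ((trinomCoeff x.l w.1 * trinomCoeff x.m w.2 : ℝ) : ℂ) *
                  (((2 : ℝ) ^ x.i.1 * 2 ^ x.i.2 : ℝ) : ℂ))‖ *
                (((x.d₁ : ℝ) * (2 ^ x.i.1 * (1 / 2)) * ((x.d₂ : ℝ) * (2 ^ x.i.2 * (1 / 2)))) ^ (-(1 / 2 : ℝ)) *
                  (((x.r + 1 : ℕ) : ℝ))⁻¹)) ^ 2) *
          ((1 + Real.log H_D) * Real.sqrt (2 * ((N : ℝ) + 1) / R + 4 * H_D))) +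
        J * (1 / 2) ^ J * (∑ x ∈ (memberSet G (2 * N) N (coreHeight ε₀) T Δ').filter (fun x ↦ x.h₁ ≠ 0 ∧
                (((switchGcd (x.r + 1) x.s x.h₁ : ℤ) ∣ ((x.l / x.d₁ : ℕ) : ℤ) * (x.m / x.d₂ : ℕ) ∧
                  IsUnit (switchClass (x.r + 1) (((x.l / x.d₁ : ℕ) : ℤ) * (x.m / x.d₂ : ℕ)) x.s x.h₁))) ∧
                D x.r x.l x.m x.d₁ x.d₂ x.i x.h₁ x.s ≠ 0),
              ‖((if Nat.Coprime (x.l / x.d₁) (x.r + 1) then (1 : ℂ) else 0) *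
                  ((if IsUnit ((x.h₁ : ℤ) : ZMod (x.r + 1)) ∧ x.h₁ ≠ 0 then (1 : ℂ) else 0) *
                    (if ((switchGcd (x.r + 1) x.s x.h₁ : ℤ) ∣ ((x.l / x.d₁ : ℕ) : ℤ) * (x.m / x.d₂ : ℕ) ∧
                        IsUnit (switchClass (x.r + 1) (((x.l / x.d₁ : ℕ) : ℤ) * (x.m / x.d₂ : ℕ)) x.s x.h₁)) then (1 : ℂ) else 0) *
                    D x.r x.l x.m x.d₁ x.d₂ x.i x.h₁ x.s) *
                  convexCoeff (fun q ↦ (coreRange Δ' ε₀ x.r x.l x.m x.d₁ x.d₂ x.i x.h₁ q ∧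
                      ¬ ((T x.r x.l x.m x.d₁ x.d₂ x.i x.h₁ : ℝ) <
                        |(x.s : ℝ) + ((((x.l / x.d₁ : ℕ) : ℤ) * (x.m / x.d₂ : ℕ) : ℤ) : ℝ) / ((q * (x.r + 1) : ℕ) : ℝ)|)) ∧
                      (N + b * L ≤ q ∧ q ≤ N + b * L + (L - 1))) (2 * N + 1) k *
                  ((trinomCoeff x.l w.1 * trinomCoeff x.m w.2 : ℝ) : ℂ) *
                  (((2 : ℝ) ^ x.i.1 * 2 ^ x.i.2 : ℝ) : ℂ))‖ *
                (((x.d₁ : ℝ) * (2 ^ x.i.1 * (1 / 2)) * ((x.d₂ : ℝ) * (2 ^ x.i.2 * (1 / 2)))) ^ (-(1 / 2 : ℝ)) *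
                  (((x.r + 1 : ℕ) : ℝ))⁻¹)) *
          ∑ q ∈ G.filter (fun q ↦ (q - N) / L = b),
            ‖e ((k : ℝ) * q / (2 * N + 1 : ℕ)) * (2 * (qhat q : ℂ) * (2 * π / q)) *
                (((Real.log (qhat q ^ Δ'))⁻¹ ^ (w.1 + w.2) : ℝ) : ℂ)‖ ≤
      2 * sepWeight (2 * N + 1) k *
        (2 * Real.sqrt (4 * ((G.filter (fun q ↦ (q - N) / L = b)).card : ℝ) / N) * Real.sqrt (∑ h ∈ Finset.Icc 1 H_D, ∑ c' ∈ (Finset.range h).filter (fun c' ↦ c'.Coprime h),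
            (∑ x ∈ ((memberSet G (2 * N) N (coreHeight ε₀) T Δ').filter (fun x ↦ x.h₁ ≠ 0 ∧
                (((switchGcd (x.r + 1) x.s x.h₁ : ℤ) ∣ ((x.l / x.d₁ : ℕ) : ℤ) * (x.m / x.d₂ : ℕ) ∧
                  IsUnit (switchClass (x.r + 1) (((x.l / x.d₁ : ℕ) : ℤ) * (x.m / x.d₂ : ℕ)) x.s x.h₁))) ∧
                D x.r x.l x.m x.d₁ x.d₂ x.i x.h₁ x.s ≠ 0)).filter
                (fun x ↦ switchMod (x.r + 1) x.s x.h₁ = h ∧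
                  (switchClass (x.r + 1) (((x.l / x.d₁ : ℕ) : ℤ) * (x.m / x.d₂ : ℕ)) x.s x.h₁).val = c'),
              ((if (∃ q ∈ Finset.Icc 1 (2 * N + 1 - 1), (coreRange Δ' ε₀ x.r x.l x.m x.d₁ x.d₂ x.i x.h₁ q ∧
                  ¬ ((T x.r x.l x.m x.d₁ x.d₂ x.i x.h₁ : ℝ) <
                    |(x.s : ℝ) + ((((x.l / x.d₁ : ℕ) : ℤ) * (x.m / x.d₂ : ℕ) : ℤ) : ℝ) / ((q * (x.r + 1) : ℕ) : ℝ)|)) ∧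
                  (N + b * L ≤ q ∧ q ≤ N + b * L + (L - 1))) then (1 : ℝ) else 0) *
                |trinomCoeff x.l w.1 * trinomCoeff x.m w.2| * (2 ^ x.i.1 * 2 ^ x.i.2) *
                (((x.d₁ : ℝ) * (2 ^ x.i.1 * (1 / 2)) * ((x.d₂ : ℝ) * (2 ^ x.i.2 * (1 / 2)))) ^ (-(1 / 2 : ℝ)) *
                  (((x.r + 1 : ℕ) : ℝ))⁻¹))) ^ 2) *
          ((1 + Real.log H_D) * Real.sqrt (2 * ((N : ℝ) + 1) / R + 4 * H_D)) +
        J * (1 / 2) ^ J * (∑ x ∈ (memberSet G (2 * N) N (coreHeight ε₀) T Δ').filter (fun x ↦ x.h₁ ≠ 0 ∧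
                (((switchGcd (x.r + 1) x.s x.h₁ : ℤ) ∣ ((x.l / x.d₁ : ℕ) : ℤ) * (x.m / x.d₂ : ℕ) ∧
                  IsUnit (switchClass (x.r + 1) (((x.l / x.d₁ : ℕ) : ℤ) * (x.m / x.d₂ : ℕ)) x.s x.h₁))) ∧
                D x.r x.l x.m x.d₁ x.d₂ x.i x.h₁ x.s ≠ 0),
              ((if (∃ q ∈ Finset.Icc 1 (2 * N + 1 - 1), (coreRange Δ' ε₀ x.r x.l x.m x.d₁ x.d₂ x.i x.h₁ q ∧
                  ¬ ((T x.r x.l x.m x.d₁ x.d₂ x.i x.h₁ : ℝ) <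
                    |(x.s : ℝ) + ((((x.l / x.d₁ : ℕ) : ℤ) * (x.m / x.d₂ : ℕ) : ℤ) : ℝ) / ((q * (x.r + 1) : ℕ) : ℝ)|)) ∧
                  (N + b * L ≤ q ∧ q ≤ N + b * L + (L - 1))) then (1 : ℝ) else 0) *
                |trinomCoeff x.l w.1 * trinomCoeff x.m w.2| * (2 ^ x.i.1 * 2 ^ x.i.2) *
                (((x.d₁ : ℝ) * (2 ^ x.i.1 * (1 / 2)) * ((x.d₂ : ℝ) * (2 ^ x.i.2 * (1 / 2)))) ^ (-(1 / 2 : ℝ)) *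
                  (((x.r + 1 : ℕ) : ℝ))⁻¹))) *
          (2 * ((G.filter (fun q ↦ (q - N) / L = b)).card : ℝ) / Real.sqrt N)) := by
  -- abbreviations and signs
  have hsW0 : 0 ≤ sepWeight (2 * N + 1) k := sepWeight_nonneg _ _
  have hN0 : (0 : ℝ) < N := by exact_mod_cast hN
  have hLS0 : 0 ≤ ((1 + Real.log H_D) * Real.sqrt (2 * ((N : ℝ) + 1) / R + 4 * H_D)) := by
    have := Real.log_natCast_nonneg H_D; positivity
  -- (1) the member weights: `‖c‖·KB ≤ 2·sepWeight·Ω`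
  have hmem : ∀ x ∈ (memberSet G (2 * N) N (coreHeight ε₀) T Δ').filter (fun x ↦ x.h₁ ≠ 0 ∧
                (((switchGcd (x.r + 1) x.s x.h₁ : ℤ) ∣ ((x.l / x.d₁ : ℕ) : ℤ) * (x.m / x.d₂ : ℕ) ∧
                  IsUnit (switchClass (x.r + 1) (((x.l / x.d₁ : ℕ) : ℤ) * (x.m / x.d₂ : ℕ)) x.s x.h₁))) ∧
                D x.r x.l x.m x.d₁ x.d₂ x.i x.h₁ x.s ≠ 0),
      ‖((if Nat.Coprime (x.l / x.d₁) (x.r + 1) then (1 : ℂ) else 0) *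
                  ((if IsUnit ((x.h₁ : ℤ) : ZMod (x.r + 1)) ∧ x.h₁ ≠ 0 then (1 : ℂ) else 0) *
                    (if ((switchGcd (x.r + 1) x.s x.h₁ : ℤ) ∣ ((x.l / x.d₁ : ℕ) : ℤ) * (x.m / x.d₂ : ℕ) ∧
                        IsUnit (switchClass (x.r + 1) (((x.l / x.d₁ : ℕ) : ℤ) * (x.m / x.d₂ : ℕ)) x.s x.h₁)) then (1 : ℂ) else 0) *
                    D x.r x.l x.m x.d₁ x.d₂ x.i x.h₁ x.s) *
                  convexCoeff (fun q ↦ (coreRange Δ' ε₀ x.r x.l x.m x.d₁ x.d₂ x.i x.h₁ q ∧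
                      ¬ ((T x.r x.l x.m x.d₁ x.d₂ x.i x.h₁ : ℝ) <
                        |(x.s : ℝ) + ((((x.l / x.d₁ : ℕ) : ℤ) * (x.m / x.d₂ : ℕ) : ℤ) : ℝ) / ((q * (x.r + 1) : ℕ) : ℝ)|)) ∧
                      (N + b * L ≤ q ∧ q ≤ N + b * L + (L - 1))) (2 * N + 1) k *
                  ((trinomCoeff x.l w.1 * trinomCoeff x.m w.2 : ℝ) : ℂ) *
                  (((2 : ℝ) ^ x.i.1 * 2 ^ x.i.2 : ℝ) : ℂ))‖ *
                (((x.d₁ : ℝ) * (2 ^ x.i.1 * (1 / 2)) * ((x.d₂ : ℝ) * (2 ^ x.i.2 * (1 / 2)))) ^ (-(1 / 2 : ℝ)) *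
                  (((x.r + 1 : ℕ) : ℝ))⁻¹) ≤
        2 * sepWeight (2 * N + 1) k * ((if (∃ q ∈ Finset.Icc 1 (2 * N + 1 - 1), (coreRange Δ' ε₀ x.r x.l x.m x.d₁ x.d₂ x.i x.h₁ q ∧
                  ¬ ((T x.r x.l x.m x.d₁ x.d₂ x.i x.h₁ : ℝ) <
                    |(x.s : ℝ) + ((((x.l / x.d₁ : ℕ) : ℤ) * (x.m / x.d₂ : ℕ) : ℤ) : ℝ) / ((q * (x.r + 1) : ℕ) : ℝ)|)) ∧
                  (N + b * L ≤ q ∧ q ≤ N + b * L + (L - 1))) then (1 : ℝ) else 0) *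
                |trinomCoeff x.l w.1 * trinomCoeff x.m w.2| * (2 ^ x.i.1 * 2 ^ x.i.2) *
                (((x.d₁ : ℝ) * (2 ^ x.i.1 * (1 / 2)) * ((x.d₂ : ℝ) * (2 ^ x.i.2 * (1 / 2)))) ^ (-(1 / 2 : ℝ)) *
                  (((x.r + 1 : ℕ) : ℝ))⁻¹)) := by
    intro x hx
    have hKB0 : 0 ≤ (((x.d₁ : ℝ) * (2 ^ x.i.1 * (1 / 2)) * ((x.d₂ : ℝ) * (2 ^ x.i.2 * (1 / 2)))) ^ (-(1 / 2 : ℝ)) *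
                  (((x.r + 1 : ℕ) : ℝ))⁻¹) := by positivity
    by_cases hact : (∃ q ∈ Finset.Icc 1 (2 * N + 1 - 1), (coreRange Δ' ε₀ x.r x.l x.m x.d₁ x.d₂ x.i x.h₁ q ∧
                  ¬ ((T x.r x.l x.m x.d₁ x.d₂ x.i x.h₁ : ℝ) <
                    |(x.s : ℝ) + ((((x.l / x.d₁ : ℕ) : ℤ) * (x.m / x.d₂ : ℕ) : ℤ) : ℝ) / ((q * (x.r + 1) : ℕ) : ℝ)|)) ∧
                  (N + b * L ≤ q ∧ q ≤ N + b * L + (L - 1)))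
    · rw [if_pos hact, one_mul]
      -- the scalar bound (structure of `norm_memberScalar_le`, inlined)
      have h1 : ‖(if Nat.Coprime (x.l / x.d₁) (x.r + 1) then (1 : ℂ) else 0)‖ ≤ 1 := by split_ifs <;> simp
      have hE : ‖((if IsUnit ((x.h₁ : ℤ) : ZMod (x.r + 1)) ∧ x.h₁ ≠ 0 then (1 : ℂ) else 0) *
                    (if ((switchGcd (x.r + 1) x.s x.h₁ : ℤ) ∣ ((x.l / x.d₁ : ℕ) : ℤ) * (x.m / x.d₂ : ℕ) ∧
                        IsUnit (switchClass (x.r + 1) (((x.l / x.d₁ : ℕ) : ℤ) * (x.m / x.d₂ : ℕ)) x.s x.h₁)) then (1 : ℂ) else 0) *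
                    D x.r x.l x.m x.d₁ x.d₂ x.i x.h₁ x.s)‖ ≤ 1 := by
        rw [norm_mul, norm_mul]
        have h2 : ‖(if IsUnit ((x.h₁ : ℤ) : ZMod (x.r + 1)) ∧ x.h₁ ≠ 0 then (1 : ℂ) else 0)‖ ≤ 1 := by split_ifs <;> simp
        have h3 : ‖(if ((switchGcd (x.r + 1) x.s x.h₁ : ℤ) ∣ ((x.l / x.d₁ : ℕ) : ℤ) * (x.m / x.d₂ : ℕ) ∧
            IsUnit (switchClass (x.r + 1) (((x.l / x.d₁ : ℕ) : ℤ) * (x.m / x.d₂ : ℕ)) x.s x.h₁)) then (1 : ℂ) else 0)‖ ≤ 1 := by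
          split_ifs <;> simp
        exact mul_le_one₀ (mul_le_one₀ h2 (norm_nonneg _) h3) (norm_nonneg _) (hDn _ _ _ _ _ _ _ _)
      have hC := norm_convexCoeff_le (fun q ↦ (coreRange Δ' ε₀ x.r x.l x.m x.d₁ x.d₂ x.i x.h₁ q ∧
                      ¬ ((T x.r x.l x.m x.d₁ x.d₂ x.i x.h₁ : ℝ) <
                        |(x.s : ℝ) + ((((x.l / x.d₁ : ℕ) : ℤ) * (x.m / x.d₂ : ℕ) : ℤ) : ℝ) / ((q * (x.r + 1) : ℕ) : ℝ)|)) ∧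
                      (N + b * L ≤ q ∧ q ≤ N + b * L + (L - 1))) hk
      have hT : ‖((trinomCoeff x.l w.1 * trinomCoeff x.m w.2 : ℝ) : ℂ)‖ = |trinomCoeff x.l w.1 * trinomCoeff x.m w.2| := by
        rw [Complex.norm_real, Real.norm_eq_abs]
      have hK : ‖(((2 : ℝ) ^ x.i.1 * 2 ^ x.i.2 : ℝ) : ℂ)‖ = 2 ^ x.i.1 * 2 ^ x.i.2 := by
        rw [Complex.norm_real, Real.norm_eq_abs, abs_of_nonneg (by positivity)]
      have hB : ‖(if Nat.Coprime (x.l / x.d₁) (x.r + 1) then (1 : ℂ) else 0) *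
          ((if IsUnit ((x.h₁ : ℤ) : ZMod (x.r + 1)) ∧ x.h₁ ≠ 0 then (1 : ℂ) else 0) *
                    (if ((switchGcd (x.r + 1) x.s x.h₁ : ℤ) ∣ ((x.l / x.d₁ : ℕ) : ℤ) * (x.m / x.d₂ : ℕ) ∧
                        IsUnit (switchClass (x.r + 1) (((x.l / x.d₁ : ℕ) : ℤ) * (x.m / x.d₂ : ℕ)) x.s x.h₁)) then (1 : ℂ) else 0) *
                    D x.r x.l x.m x.d₁ x.d₂ x.i x.h₁ x.s) *
          convexCoeff (fun q ↦ (coreRange Δ' ε₀ x.r x.l x.m x.d₁ x.d₂ x.i x.h₁ q ∧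
                      ¬ ((T x.r x.l x.m x.d₁ x.d₂ x.i x.h₁ : ℝ) <
                        |(x.s : ℝ) + ((((x.l / x.d₁ : ℕ) : ℤ) * (x.m / x.d₂ : ℕ) : ℤ) : ℝ) / ((q * (x.r + 1) : ℕ) : ℝ)|)) ∧
                      (N + b * L ≤ q ∧ q ≤ N + b * L + (L - 1))) (2 * N + 1) k‖ ≤ 2 * sepWeight (2 * N + 1) k := by
        rw [norm_mul, norm_mul]
        calc _ ≤ 1 * 1 * (2 * sepWeight (2 * N + 1) k) :=
            mul_le_mul (mul_le_mul h1 hE (norm_nonneg _) zero_le_one) hC (norm_nonneg _) (by positivity)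
          _ = _ := by ring
      have hBt : ‖(if Nat.Coprime (x.l / x.d₁) (x.r + 1) then (1 : ℂ) else 0) *
          ((if IsUnit ((x.h₁ : ℤ) : ZMod (x.r + 1)) ∧ x.h₁ ≠ 0 then (1 : ℂ) else 0) *
                    (if ((switchGcd (x.r + 1) x.s x.h₁ : ℤ) ∣ ((x.l / x.d₁ : ℕ) : ℤ) * (x.m / x.d₂ : ℕ) ∧
                        IsUnit (switchClass (x.r + 1) (((x.l / x.d₁ : ℕ) : ℤ) * (x.m / x.d₂ : ℕ)) x.s x.h₁)) then (1 : ℂ) else 0) *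
                    D x.r x.l x.m x.d₁ x.d₂ x.i x.h₁ x.s) *
          convexCoeff (fun q ↦ (coreRange Δ' ε₀ x.r x.l x.m x.d₁ x.d₂ x.i x.h₁ q ∧
                      ¬ ((T x.r x.l x.m x.d₁ x.d₂ x.i x.h₁ : ℝ) <
                        |(x.s : ℝ) + ((((x.l / x.d₁ : ℕ) : ℤ) * (x.m / x.d₂ : ℕ) : ℤ) : ℝ) / ((q * (x.r + 1) : ℕ) : ℝ)|)) ∧
                      (N + b * L ≤ q ∧ q ≤ N + b * L + (L - 1))) (2 * N + 1) k *
          ((trinomCoeff x.l w.1 * trinomCoeff x.m w.2 : ℝ) : ℂ)‖ ≤ 2 * sepWeight (2 * N + 1) k * |trinomCoeff x.l w.1 * trinomCoeff x.m w.2| := by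
        rw [norm_mul, hT]
        exact mul_le_mul_of_nonneg_right hB (abs_nonneg _)
      have hc : ‖((if Nat.Coprime (x.l / x.d₁) (x.r + 1) then (1 : ℂ) else 0) *
                  ((if IsUnit ((x.h₁ : ℤ) : ZMod (x.r + 1)) ∧ x.h₁ ≠ 0 then (1 : ℂ) else 0) *
                    (if ((switchGcd (x.r + 1) x.s x.h₁ : ℤ) ∣ ((x.l / x.d₁ : ℕ) : ℤ) * (x.m / x.d₂ : ℕ) ∧
                        IsUnit (switchClass (x.r + 1) (((x.l / x.d₁ : ℕ) : ℤ) * (x.m / x.d₂ : ℕ)) x.s x.h₁)) then (1 : ℂ) else 0) *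
                    D x.r x.l x.m x.d₁ x.d₂ x.i x.h₁ x.s) *
                  convexCoeff (fun q ↦ (coreRange Δ' ε₀ x.r x.l x.m x.d₁ x.d₂ x.i x.h₁ q ∧
                      ¬ ((T x.r x.l x.m x.d₁ x.d₂ x.i x.h₁ : ℝ) <
                        |(x.s : ℝ) + ((((x.l / x.d₁ : ℕ) : ℤ) * (x.m / x.d₂ : ℕ) : ℤ) : ℝ) / ((q * (x.r + 1) : ℕ) : ℝ)|)) ∧
                      (N + b * L ≤ q ∧ q ≤ N + b * L + (L - 1))) (2 * N + 1) k *
                  ((trinomCoeff x.l w.1 * trinomCoeff x.m w.2 : ℝ) : ℂ) *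
                  (((2 : ℝ) ^ x.i.1 * 2 ^ x.i.2 : ℝ) : ℂ))‖ ≤
          2 * sepWeight (2 * N + 1) k * |trinomCoeff x.l w.1 * trinomCoeff x.m w.2| * (2 ^ x.i.1 * 2 ^ x.i.2) := by
        rw [norm_mul, hK]
        exact mul_le_mul_of_nonneg_right hBt (by positivity)
      calc _ ≤ (2 * sepWeight (2 * N + 1) k * |trinomCoeff x.l w.1 * trinomCoeff x.m w.2| * (2 ^ x.i.1 * 2 ^ x.i.2)) *
            (((x.d₁ : ℝ) * (2 ^ x.i.1 * (1 / 2)) * ((x.d₂ : ℝ) * (2 ^ x.i.2 * (1 / 2)))) ^ (-(1 / 2 : ℝ)) *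
                  (((x.r + 1 : ℕ) : ℝ))⁻¹) := mul_le_mul_of_nonneg_right hc hKB0
        _ = _ := by ring
    · -- inactive member: the completion coefficient vanishes
      have hCc : convexCoeff (fun q ↦ (coreRange Δ' ε₀ x.r x.l x.m x.d₁ x.d₂ x.i x.h₁ q ∧
                      ¬ ((T x.r x.l x.m x.d₁ x.d₂ x.i x.h₁ : ℝ) <
                        |(x.s : ℝ) + ((((x.l / x.d₁ : ℕ) : ℤ) * (x.m / x.d₂ : ℕ) : ℤ) : ℝ) / ((q * (x.r + 1) : ℕ) : ℝ)|)) ∧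
                      (N + b * L ≤ q ∧ q ≤ N + b * L + (L - 1))) (2 * N + 1) k = 0 :=
        convexCoeff_eq_zero_of_forall_not (fun q hq hpq ↦ hact ⟨q, hq, hpq⟩) k
      rw [hCc, if_neg hact]
      simp
  -- (2) the fibre aggregate and the mass
  have hFIB : Real.sqrt (∑ h ∈ Finset.Icc 1 H_D, ∑ c' ∈ (Finset.range h).filter (fun c' ↦ c'.Coprime h),
            (∑ x ∈ ((memberSet G (2 * N) N (coreHeight ε₀) T Δ').filter (fun x ↦ x.h₁ ≠ 0 ∧
                (((switchGcd (x.r + 1) x.s x.h₁ : ℤ) ∣ ((x.l / x.d₁ : ℕ) : ℤ) * (x.m / x.d₂ : ℕ) ∧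
                  IsUnit (switchClass (x.r + 1) (((x.l / x.d₁ : ℕ) : ℤ) * (x.m / x.d₂ : ℕ)) x.s x.h₁))) ∧
                D x.r x.l x.m x.d₁ x.d₂ x.i x.h₁ x.s ≠ 0)).filter
                (fun x ↦ switchMod (x.r + 1) x.s x.h₁ = h ∧
                  (switchClass (x.r + 1) (((x.l / x.d₁ : ℕ) : ℤ) * (x.m / x.d₂ : ℕ)) x.s x.h₁).val = c'),
              ‖((if Nat.Coprime (x.l / x.d₁) (x.r + 1) then (1 : ℂ) else 0) *
                  ((if IsUnit ((x.h₁ : ℤ) : ZMod (x.r + 1)) ∧ x.h₁ ≠ 0 then (1 : ℂ) else 0) *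
                    (if ((switchGcd (x.r + 1) x.s x.h₁ : ℤ) ∣ ((x.l / x.d₁ : ℕ) : ℤ) * (x.m / x.d₂ : ℕ) ∧
                        IsUnit (switchClass (x.r + 1) (((x.l / x.d₁ : ℕ) : ℤ) * (x.m / x.d₂ : ℕ)) x.s x.h₁)) then (1 : ℂ) else 0) *
                    D x.r x.l x.m x.d₁ x.d₂ x.i x.h₁ x.s) *
                  convexCoeff (fun q ↦ (coreRange Δ' ε₀ x.r x.l x.m x.d₁ x.d₂ x.i x.h₁ q ∧
                      ¬ ((T x.r x.l x.m x.d₁ x.d₂ x.i x.h₁ : ℝ) <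
                        |(x.s : ℝ) + ((((x.l / x.d₁ : ℕ) : ℤ) * (x.m / x.d₂ : ℕ) : ℤ) : ℝ) / ((q * (x.r + 1) : ℕ) : ℝ)|)) ∧
                      (N + b * L ≤ q ∧ q ≤ N + b * L + (L - 1))) (2 * N + 1) k *
                  ((trinomCoeff x.l w.1 * trinomCoeff x.m w.2 : ℝ) : ℂ) *
                  (((2 : ℝ) ^ x.i.1 * 2 ^ x.i.2 : ℝ) : ℂ))‖ *
                (((x.d₁ : ℝ) * (2 ^ x.i.1 * (1 / 2)) * ((x.d₂ : ℝ) * (2 ^ x.i.2 * (1 / 2)))) ^ (-(1 / 2 : ℝ)) *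
                  (((x.r + 1 : ℕ) : ℝ))⁻¹)) ^ 2) ≤
      2 * sepWeight (2 * N + 1) k * Real.sqrt (∑ h ∈ Finset.Icc 1 H_D, ∑ c' ∈ (Finset.range h).filter (fun c' ↦ c'.Coprime h),
            (∑ x ∈ ((memberSet G (2 * N) N (coreHeight ε₀) T Δ').filter (fun x ↦ x.h₁ ≠ 0 ∧
                (((switchGcd (x.r + 1) x.s x.h₁ : ℤ) ∣ ((x.l / x.d₁ : ℕ) : ℤ) * (x.m / x.d₂ : ℕ) ∧
                  IsUnit (switchClass (x.r + 1) (((x.l / x.d₁ : ℕ) : ℤ) * (x.m / x.d₂ : ℕ)) x.s x.h₁))) ∧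
                D x.r x.l x.m x.d₁ x.d₂ x.i x.h₁ x.s ≠ 0)).filter
                (fun x ↦ switchMod (x.r + 1) x.s x.h₁ = h ∧
                  (switchClass (x.r + 1) (((x.l / x.d₁ : ℕ) : ℤ) * (x.m / x.d₂ : ℕ)) x.s x.h₁).val = c'),
              ((if (∃ q ∈ Finset.Icc 1 (2 * N + 1 - 1), (coreRange Δ' ε₀ x.r x.l x.m x.d₁ x.d₂ x.i x.h₁ q ∧
                  ¬ ((T x.r x.l x.m x.d₁ x.d₂ x.i x.h₁ : ℝ) <
                    |(x.s : ℝ) + ((((x.l / x.d₁ : ℕ) : ℤ) * (x.m / x.d₂ : ℕ) : ℤ) : ℝ) / ((q * (x.r + 1) : ℕ) : ℝ)|)) ∧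
                  (N + b * L ≤ q ∧ q ≤ N + b * L + (L - 1))) then (1 : ℝ) else 0) *
                |trinomCoeff x.l w.1 * trinomCoeff x.m w.2| * (2 ^ x.i.1 * 2 ^ x.i.2) *
                (((x.d₁ : ℝ) * (2 ^ x.i.1 * (1 / 2)) * ((x.d₂ : ℝ) * (2 ^ x.i.2 * (1 / 2)))) ^ (-(1 / 2 : ℝ)) *
                  (((x.r + 1 : ℕ) : ℝ))⁻¹))) ^ 2) := by
    rw [← Real.sqrt_sq (by positivity : (0 : ℝ) ≤ 2 * sepWeight (2 * N + 1) k), ← Real.sqrt_mul (sq_nonneg _)]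
    refine Real.sqrt_le_sqrt ?_
    rw [Finset.mul_sum]
    refine Finset.sum_le_sum fun h _ ↦ ?_
    rw [Finset.mul_sum]
    refine Finset.sum_le_sum fun c' _ ↦ ?_
    rw [← mul_pow]
    refine pow_le_pow_left₀ (Finset.sum_nonneg fun x _ ↦ by positivity) ?_ 2
    rw [Finset.mul_sum]
    exact Finset.sum_le_sum fun x hx ↦ hmem x (Finset.mem_filter.mp hx).1
  have hMASS : ∑ x ∈ (memberSet G (2 * N) N (coreHeight ε₀) T Δ').filter (fun x ↦ x.h₁ ≠ 0 ∧
                (((switchGcd (x.r + 1) x.s x.h₁ : ℤ) ∣ ((x.l / x.d₁ : ℕ) : ℤ) * (x.m / x.d₂ : ℕ) ∧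
                  IsUnit (switchClass (x.r + 1) (((x.l / x.d₁ : ℕ) : ℤ) * (x.m / x.d₂ : ℕ)) x.s x.h₁))) ∧
                D x.r x.l x.m x.d₁ x.d₂ x.i x.h₁ x.s ≠ 0),
              ‖((if Nat.Coprime (x.l / x.d₁) (x.r + 1) then (1 : ℂ) else 0) *
                  ((if IsUnit ((x.h₁ : ℤ) : ZMod (x.r + 1)) ∧ x.h₁ ≠ 0 then (1 : ℂ) else 0) *
                    (if ((switchGcd (x.r + 1) x.s x.h₁ : ℤ) ∣ ((x.l / x.d₁ : ℕ) : ℤ) * (x.m / x.d₂ : ℕ) ∧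
                        IsUnit (switchClass (x.r + 1) (((x.l / x.d₁ : ℕ) : ℤ) * (x.m / x.d₂ : ℕ)) x.s x.h₁)) then (1 : ℂ) else 0) *
                    D x.r x.l x.m x.d₁ x.d₂ x.i x.h₁ x.s) *
                  convexCoeff (fun q ↦ (coreRange Δ' ε₀ x.r x.l x.m x.d₁ x.d₂ x.i x.h₁ q ∧
                      ¬ ((T x.r x.l x.m x.d₁ x.d₂ x.i x.h₁ : ℝ) <
                        |(x.s : ℝ) + ((((x.l / x.d₁ : ℕ) : ℤ) * (x.m / x.d₂ : ℕ) : ℤ) : ℝ) / ((q * (x.r + 1) : ℕ) : ℝ)|)) ∧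
                      (N + b * L ≤ q ∧ q ≤ N + b * L + (L - 1))) (2 * N + 1) k *
                  ((trinomCoeff x.l w.1 * trinomCoeff x.m w.2 : ℝ) : ℂ) *
                  (((2 : ℝ) ^ x.i.1 * 2 ^ x.i.2 : ℝ) : ℂ))‖ *
                (((x.d₁ : ℝ) * (2 ^ x.i.1 * (1 / 2)) * ((x.d₂ : ℝ) * (2 ^ x.i.2 * (1 / 2)))) ^ (-(1 / 2 : ℝ)) *
                  (((x.r + 1 : ℕ) : ℝ))⁻¹) ≤
      2 * sepWeight (2 * N + 1) k * (∑ x ∈ (memberSet G (2 * N) N (coreHeight ε₀) T Δ').filter (fun x ↦ x.h₁ ≠ 0 ∧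
                (((switchGcd (x.r + 1) x.s x.h₁ : ℤ) ∣ ((x.l / x.d₁ : ℕ) : ℤ) * (x.m / x.d₂ : ℕ) ∧
                  IsUnit (switchClass (x.r + 1) (((x.l / x.d₁ : ℕ) : ℤ) * (x.m / x.d₂ : ℕ)) x.s x.h₁))) ∧
                D x.r x.l x.m x.d₁ x.d₂ x.i x.h₁ x.s ≠ 0),
              ((if (∃ q ∈ Finset.Icc 1 (2 * N + 1 - 1), (coreRange Δ' ε₀ x.r x.l x.m x.d₁ x.d₂ x.i x.h₁ q ∧
                  ¬ ((T x.r x.l x.m x.d₁ x.d₂ x.i x.h₁ : ℝ) <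
                    |(x.s : ℝ) + ((((x.l / x.d₁ : ℕ) : ℤ) * (x.m / x.d₂ : ℕ) : ℤ) : ℝ) / ((q * (x.r + 1) : ℕ) : ℝ)|)) ∧
                  (N + b * L ≤ q ∧ q ≤ N + b * L + (L - 1))) then (1 : ℝ) else 0) *
                |trinomCoeff x.l w.1 * trinomCoeff x.m w.2| * (2 ^ x.i.1 * 2 ^ x.i.2) *
                (((x.d₁ : ℝ) * (2 ^ x.i.1 * (1 / 2)) * ((x.d₂ : ℝ) * (2 ^ x.i.2 * (1 / 2)))) ^ (-(1 / 2 : ℝ)) *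
                  (((x.r + 1 : ℕ) : ℝ))⁻¹))) := by
    rw [Finset.mul_sum]
    exact Finset.sum_le_sum fun x hx ↦ hmem x hx
  -- (3) the universal factors ($₁)
  have hβ₁ : (0 : ℝ) < ((N + b * L : ℕ) : ℝ) := by
    have : 0 < N + b * L := by omega
    exact_mod_cast this
  have hβ₂ : (0 : ℝ) < ((N + b * L + (L - 1) + 1 : ℕ) : ℝ) := by positivity
  have hlt : ((N + b * L : ℕ) : ℝ) < ((N + b * L + (L - 1) + 1 : ℕ) : ℝ) := by exact_mod_cast (by omega)
  have hℓ : (0 : ℝ) < (((N + b * L : ℕ) : ℝ))⁻¹ - (((N + b * L + (L - 1) + 1 : ℕ) : ℝ))⁻¹ := by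
    rw [sub_pos]
    exact (inv_lt_inv₀ hβ₂ hβ₁).mpr hlt
  have hQb : ∀ q ∈ G.filter (fun q ↦ (q - N) / L = b), N < q := fun q hq ↦ (hG q (Finset.mem_filter.mp hq).1).2.1
  have hQe : ∀ q ∈ G.filter (fun q ↦ (q - N) / L = b), Real.exp 1 ≤ qhat q ^ Δ' := fun q hq ↦ hGe q (Finset.mem_filter.mp hq).1
  have hQt : ∀ q ∈ G.filter (fun q ↦ (q - N) / L = b), ((q : ℝ))⁻¹ ∈
      Set.Icc ((((N + b * L + (L - 1) + 1 : ℕ) : ℝ))⁻¹)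
        ((((N + b * L + (L - 1) + 1 : ℕ) : ℝ))⁻¹ + ((((N + b * L : ℕ) : ℝ))⁻¹ - (((N + b * L + (L - 1) + 1 : ℕ) : ℝ))⁻¹)) := by
    intro q hq
    obtain ⟨hqG, hkey⟩ := Finset.mem_filter.mp hq
    obtain ⟨hb1, hb2⟩ := (blockKey_eq_iff hL (hG q hqG).2.1.le).mp hkey
    have hq0 : (0 : ℝ) < q := by exact_mod_cast (hG q hqG).1.pos
    rw [add_sub_cancel]
    constructor
    · exact (inv_le_inv₀ hβ₂ hq0).mpr (by exact_mod_cast (by omega : q ≤ N + b * L + (L - 1) + 1))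
    · exact (inv_le_inv₀ hq0 hβ₁).mpr (by exact_mod_cast hb1)
  have hU : (∑ j ∈ Finset.range J, (1 / 2 : ℝ) ^ j *
          Real.sqrt (∑ q ∈ G.filter (fun q ↦ (q - N) / L = b),
            ‖(e ((k : ℝ) * q / (2 * N + 1 : ℕ)) * (2 * (qhat q : ℂ) * (2 * π / q)) *
                (((Real.log (qhat q ^ Δ'))⁻¹ ^ (w.1 + w.2) : ℝ) : ℂ)) *
              ((((((q : ℝ))⁻¹ - (((N + b * L + (L - 1) + 1 : ℕ) : ℝ))⁻¹) /
                ((((N + b * L : ℕ) : ℝ))⁻¹ - (((N + b * L + (L - 1) + 1 : ℕ) : ℝ))⁻¹)) ^ j : ℝ) : ℂ)‖ ^ 2)) ≤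
      2 * Real.sqrt (4 * ((G.filter (fun q ↦ (q - N) / L = b)).card : ℝ) / N) := by
    calc _ ≤ ∑ j ∈ Finset.range J, (1 / 2 : ℝ) ^ j *
          Real.sqrt (4 * ((G.filter (fun q ↦ (q - N) / L = b)).card : ℝ) / N) := by
          refine Finset.sum_le_sum fun j _ ↦ mul_le_mul_of_nonneg_left (Real.sqrt_le_sqrt ?_) (by positivity)
          exact sum_norm_sq_universalWeight_le _ hN hQb hQe k (2 * N + 1) (w.1 + w.2) hℓ hQt j
      _ = (∑ j ∈ Finset.range J, (1 / 2 : ℝ) ^ j) *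
          Real.sqrt (4 * ((G.filter (fun q ↦ (q - N) / L = b)).card : ℝ) / N) := by rw [Finset.sum_mul]
      _ ≤ _ := mul_le_mul_of_nonneg_right (sum_geometric_two_le J) (Real.sqrt_nonneg _)
  have hG1 : ∑ q ∈ G.filter (fun q ↦ (q - N) / L = b),
            ‖e ((k : ℝ) * q / (2 * N + 1 : ℕ)) * (2 * (qhat q : ℂ) * (2 * π / q)) *
                (((Real.log (qhat q ^ Δ'))⁻¹ ^ (w.1 + w.2) : ℝ) : ℂ)‖ ≤
      2 * ((G.filter (fun q ↦ (q - N) / L = b)).card : ℝ) / Real.sqrt N :=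
    sum_norm_universalWeight_le _ hN hQb hQe k (2 * N + 1) (w.1 + w.2)
  -- (4) assemble
  have hG10 : 0 ≤ ∑ q ∈ G.filter (fun q ↦ (q - N) / L = b),
            ‖e ((k : ℝ) * q / (2 * N + 1 : ℕ)) * (2 * (qhat q : ℂ) * (2 * π / q)) *
                (((Real.log (qhat q ^ Δ'))⁻¹ ^ (w.1 + w.2) : ℝ) : ℂ)‖ := Finset.sum_nonneg fun q _ ↦ norm_nonneg _
  calc _ ≤ (2 * Real.sqrt (4 * ((G.filter (fun q ↦ (q - N) / L = b)).card : ℝ) / N)) *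
        ((2 * sepWeight (2 * N + 1) k * Real.sqrt (∑ h ∈ Finset.Icc 1 H_D, ∑ c' ∈ (Finset.range h).filter (fun c' ↦ c'.Coprime h),
            (∑ x ∈ ((memberSet G (2 * N) N (coreHeight ε₀) T Δ').filter (fun x ↦ x.h₁ ≠ 0 ∧
                (((switchGcd (x.r + 1) x.s x.h₁ : ℤ) ∣ ((x.l / x.d₁ : ℕ) : ℤ) * (x.m / x.d₂ : ℕ) ∧
                  IsUnit (switchClass (x.r + 1) (((x.l / x.d₁ : ℕ) : ℤ) * (x.m / x.d₂ : ℕ)) x.s x.h₁))) ∧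
                D x.r x.l x.m x.d₁ x.d₂ x.i x.h₁ x.s ≠ 0)).filter
                (fun x ↦ switchMod (x.r + 1) x.s x.h₁ = h ∧
                  (switchClass (x.r + 1) (((x.l / x.d₁ : ℕ) : ℤ) * (x.m / x.d₂ : ℕ)) x.s x.h₁).val = c'),
              ((if (∃ q ∈ Finset.Icc 1 (2 * N + 1 - 1), (coreRange Δ' ε₀ x.r x.l x.m x.d₁ x.d₂ x.i x.h₁ q ∧
                  ¬ ((T x.r x.l x.m x.d₁ x.d₂ x.i x.h₁ : ℝ) <
                    |(x.s : ℝ) + ((((x.l / x.d₁ : ℕ) : ℤ) * (x.m / x.d₂ : ℕ) : ℤ) : ℝ) / ((q * (x.r + 1) : ℕ) : ℝ)|)) ∧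
                  (N + b * L ≤ q ∧ q ≤ N + b * L + (L - 1))) then (1 : ℝ) else 0) *
                |trinomCoeff x.l w.1 * trinomCoeff x.m w.2| * (2 ^ x.i.1 * 2 ^ x.i.2) *
                (((x.d₁ : ℝ) * (2 ^ x.i.1 * (1 / 2)) * ((x.d₂ : ℝ) * (2 ^ x.i.2 * (1 / 2)))) ^ (-(1 / 2 : ℝ)) *
                  (((x.r + 1 : ℕ) : ℝ))⁻¹))) ^ 2)) *
          ((1 + Real.log H_D) * Real.sqrt (2 * ((N : ℝ) + 1) / R + 4 * H_D))) +
        J * (1 / 2) ^ J * (2 * sepWeight (2 * N + 1) k * (∑ x ∈ (memberSet G (2 * N) N (coreHeight ε₀) T Δ').filter (fun x ↦ x.h₁ ≠ 0 ∧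
                (((switchGcd (x.r + 1) x.s x.h₁ : ℤ) ∣ ((x.l / x.d₁ : ℕ) : ℤ) * (x.m / x.d₂ : ℕ) ∧
                  IsUnit (switchClass (x.r + 1) (((x.l / x.d₁ : ℕ) : ℤ) * (x.m / x.d₂ : ℕ)) x.s x.h₁))) ∧
                D x.r x.l x.m x.d₁ x.d₂ x.i x.h₁ x.s ≠ 0),
              ((if (∃ q ∈ Finset.Icc 1 (2 * N + 1 - 1), (coreRange Δ' ε₀ x.r x.l x.m x.d₁ x.d₂ x.i x.h₁ q ∧
                  ¬ ((T x.r x.l x.m x.d₁ x.d₂ x.i x.h₁ : ℝ) <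
                    |(x.s : ℝ) + ((((x.l / x.d₁ : ℕ) : ℤ) * (x.m / x.d₂ : ℕ) : ℤ) : ℝ) / ((q * (x.r + 1) : ℕ) : ℝ)|)) ∧
                  (N + b * L ≤ q ∧ q ≤ N + b * L + (L - 1))) then (1 : ℝ) else 0) *
                |trinomCoeff x.l w.1 * trinomCoeff x.m w.2| * (2 ^ x.i.1 * 2 ^ x.i.2) *
                (((x.d₁ : ℝ) * (2 ^ x.i.1 * (1 / 2)) * ((x.d₂ : ℝ) * (2 ^ x.i.2 * (1 / 2)))) ^ (-(1 / 2 : ℝ)) *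
                  (((x.r + 1 : ℕ) : ℝ))⁻¹)))) *
          (2 * ((G.filter (fun q ↦ (q - N) / L = b)).card : ℝ) / Real.sqrt N) := by
        refine add_le_add ?_ ?_
        · exact mul_le_mul hU (mul_le_mul_of_nonneg_right hFIB hLS0) (by positivity) (by positivity)
        · exact mul_le_mul (mul_le_mul_of_nonneg_left hMASS (by positivity)) hG1 hG10 (by positivity)
    _ = _ := by ring

end Summit.Parity.GeneralizedHardyLittlewood.Theorems.BeyondDiagonalBeatsQuarter.OffDiag
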